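import Literature.Computability.AlgebraicComplexity.Kum19HomogeneousABPGeneral
import Mathlib.RingTheory.Ideal.KrullsHeightTheorem
import HarnessLib

/-!
# CKSV 2022, Thm. 7 for an arbitrary polynomial with a robust singular-locus bound (§1.5, closing remark)

P. Chatterjee, M. Kumar, A. She, B. L. Volk, *Quadratic lower bounds for algebraic branching programs
and formulas*, comput. complex. **31** (2022) 8 (arXiv:1911.11793), §1.5 (TeX L205): "In general,
these lower bounds hold for any family of polynomials of high enough degree whose zeroes of
multiplicity at least two lie in a low dimensional variety, or more formally, an analog of Claim 9
or Lemma 24 is true." This file makes the ABP half of that sentence precise and proves it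
(assembled in this tree; the printed remark carries no proof): CKSV **Theorem 7** (the robust lower
bound for ABPs of bounded formal degree, printed for `Σ x_i^n`; tree:
`chatterjeeKumarSheVolk2022_thm_7_general`) with the power sum replaced by ANY polynomial `f` and
Claim 9 / Lemma 24 replaced by the HYPOTHESIS they establish, in the height currency of the tree
(`codim = Ideal.height`):

  hypothesis `hc` ("robust height `≥ c` in degree `d`"):  for all `g_1, …, g_n` of degree
  `≤ d − 2`, every prime ideal containing all `∂_i f − g_i` has height `≥ c`  ("the variety `𝕍(∂_i f − g_i : i)` has dimension `≤ n − c`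
  for every perturbation of degree `≤ d − 2`" — Claim 9 is this with `c = n` for `Σ x_i^d`,
  Lemma 24 is this with `c = n − (d−2)` for `ESYM(n,d)`).

## What is proved

* `CKSV2022.le_two_mul_card_of_eq_sum_mul_add` — **the robust counting step** (the argument of the
  proofs of Thm. 7 / Thm. 31, TeX L893–900, for arbitrary `f`): if `f = Σ_{j∈ι} P_j Q_j + R` with
  `P_j(0) = Q_j(0) = 0` and `deg R < d`, then `c ≤ 2|ι|` — the `∂_i f − ∂_i R` lie in
  `I = (P_j, Q_j) ⊆ 𝔪_0`, a minimal prime of `I` below `𝔪_0` has height `≤ 2|ι|` (Krull's height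
  theorem) and `≥ c` (hypothesis with `g_i = ∂_i R`).
* `CKSV2022.thm_7_of_robustHeight` — **Thm. 7 for such `f`**, printed generality (labels of degree
  `≤ Δ`, `Kumar2019.ABPDegFormalDegreeComputes k Δ d`): an ABP of formal degree `≤ d` computing
  `f + Σ_{j<r} A_j B_j + R` (`A_j(0) = B_j(0) = 0`, `deg R < d`) satisfies
  `(⌊d/Δ⌋ − 1)·c ≤ 2k + 2(⌊d/Δ⌋ − 1)·r`; proof = the tree's proof of
  `chatterjeeKumarSheVolk2022_thm_7_general` verbatim (interval classes
  `S_i = {iΔ ≤ φ < (i+1)Δ}`, `Kumar2019.exists_formalDegInterval_decomposition`, constants stripped)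
  with the counting step above in place of the power-sum width lemma; and the affine-label form
  `CKSV2022.thm_7_of_robustHeight_affine` (`Δ = 1`: `(d − 1)·c ≤ 2k + 2(d − 1)·r`).
* `CKSV2022.robustHeight_psum` — **the instance `c = n` for `Σ x_i^d`** (`(d : K) ≠ 0`; CKSV
  Claim 9 in height form: `K[x]/𝔭` is finite over `K` because the `x_i^{d−1}` are leading terms —
  the tree's `KumarVolk.moduleFinite_quotient_of_pow_sub_mem` — so `𝔭` is maximal, of height `n` by
  the dimension formula `Literature.RingTheory.KrullDimension.ringKrullDim_quotient_add_height`);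
  with `thm_7_of_robustHeight` this re-derives `chatterjeeKumarSheVolk2022_thm_7_general`.
* NOT proved here: the instance `c = n − (d−2)` for `ESYM(n,d)` = CKSV **Lemma 24** (robust
  singular locus of the elementary symmetric polynomial; its printed proof is a Gröbner
  degeneration, Lemma 25 / [CLO07, §9.3]) — with it, `thm_7_of_robustHeight` is Thm. 7 for
  `ESYM`, the input of the ABP remark of §1.5 and (via §4) of Thm. 2 for `ESYM`. The exact
  (`R = 0`, formal degree `d`) case for `ESYM` is `CKSV2022.esymm_abp_formalDegree_lower_bound`
  (file `CKSV22EsymABPLowerBound`).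

D-0026: no named facts and no definitions; the robust height bound is an explicit HYPOTHESIS `hc` of
each theorem (spelled out below), instantiated for power sums by the theorem `robustHeight_psum`.

## References
* [ChatterjeeKumarSheVolk2022] P. Chatterjee, M. Kumar, A. She, B. L. Volk, comput. complex. 31
  (2022) 8, arXiv:1911.11793 — §1.5 (closing remark), Lemma 4, Thm. 7 (proof), Claim 9, Lemma 24.
* [Kumar2019] M. Kumar, comput. complex. 28 (2019) 409–435 — Thm. 18 (the cut).
-/

noncomputable section

open MvPolynomial Finset

namespace Literature.Computability.AlgebraicComplexity

namespace CKSV2022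

open Kumar2019

variable {K : Type*} [Field K]

section Degree

variable {R : Type*} [CommRing R] {σ : Type*}

/-- A partial derivative lowers the total degree by one. [folklore] -/
private theorem totalDegree_pderiv_le' (i : σ) (p : MvPolynomial σ R) :
    (pderiv i p).totalDegree ≤ p.totalDegree - 1 := by
  classical
  conv_lhs => rw [p.as_sum]
  rw [map_sum]
  refine totalDegree_finsetSum_le fun s hs => ?_
  rw [pderiv_monomial]
  by_cases hsi : s i = 0
  · simp [hsi]
  · refine (totalDegree_monomial_le _ _).trans ?_
    have hle : Finsupp.single i 1 ≤ s := by
      rw [Finsupp.single_le_iff]; omega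
    have h1 : ((s - Finsupp.single i 1).sum fun _ e => e) + 1 = s.sum fun _ e => e := by
      conv_rhs => rw [← tsub_add_cancel_of_le hle]
      rw [Finsupp.sum_add_index' (fun _ => rfl) (fun _ _ _ => rfl), Finsupp.sum_single_index rfl]
    have h1' : ((s - Finsupp.single i 1).sum fun _ => id) =
        (s - Finsupp.single i 1).sum fun _ e => e := rfl
    have h2 : (s.sum fun _ e => e) ≤ p.totalDegree := le_totalDegree hs
    omega

end Degree

/-- **The robust counting step** (CKSV, proofs of Thm. 7 / Thm. 31, for an arbitrary `f` under the
robust height hypothesis `hc`): if `f = Σ_{j∈ι} P_j·Q_j + R` with `P_j(0) = Q_j(0) = 0` and `deg R < d`, then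
`c ≤ 2|ι|`. Assembled in this tree. [cite: ChatterjeeKumarSheVolk2022, Thm. 7 (proof), Thm. 31 (proof)] -/
theorem le_two_mul_card_of_eq_sum_mul_add {n d c : ℕ} {f : MvPolynomial (Fin n) K}
    (hc : ∀ g : Fin n → MvPolynomial (Fin n) K, (∀ i, (g i).totalDegree ≤ d - 2) →
      ∀ 𝔭 : Ideal (MvPolynomial (Fin n) K), 𝔭.IsPrime → (∀ i, pderiv i f - g i ∈ 𝔭) →
        (c : ℕ∞) ≤ 𝔭.height) {ι : Type*} [Fintype ι] (P Q : ι → MvPolynomial (Fin n) K)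
    (hP : ∀ j, constantCoeff (P j) = 0) (hQ : ∀ j, constantCoeff (Q j) = 0)
    (R : MvPolynomial (Fin n) K) (hR : R.totalDegree < d) (h : f = ∑ j, P j * Q j + R) :
    c ≤ 2 * Fintype.card ι := by
  classical
  let s : Finset (MvPolynomial (Fin n) K) := Finset.univ.image P ∪ Finset.univ.image Q
  let I : Ideal (MvPolynomial (Fin n) K) := Ideal.span (s : Set _)
  let 𝔪 : Ideal (MvPolynomial (Fin n) K) :=
    RingHom.ker (constantCoeff : MvPolynomial (Fin n) K →+* K)
  have hscard : s.card ≤ 2 * Fintype.card ι := by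
    refine (Finset.card_union_le _ _).trans ?_
    have h1 := Finset.card_image_le (s := Finset.univ) (f := P)
    have h2 := Finset.card_image_le (s := Finset.univ) (f := Q)
    rw [Finset.card_univ] at h1 h2
    omega
  have hPI : ∀ j, P j ∈ I := fun j => Ideal.subset_span (Finset.mem_coe.2
    (Finset.mem_union_left _ (Finset.mem_image_of_mem _ (Finset.mem_univ j))))
  have hQI : ∀ j, Q j ∈ I := fun j => Ideal.subset_span (Finset.mem_coe.2
    (Finset.mem_union_right _ (Finset.mem_image_of_mem _ (Finset.mem_univ j))))
  have hI𝔪 : I ≤ 𝔪 := by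
    rw [Ideal.span_le]
    intro g hg
    rw [SetLike.mem_coe, RingHom.mem_ker]
    rcases Finset.mem_union.1 (Finset.mem_coe.1 hg) with hg | hg
    · obtain ⟨j, -, rfl⟩ := Finset.mem_image.1 hg; exact hP j
    · obtain ⟨j, -, rfl⟩ := Finset.mem_image.1 hg; exact hQ j
  -- product rule: `∂_i f − ∂_i R ∈ I`
  have hderiv : ∀ i, pderiv i f - pderiv i R ∈ I := by
    intro i
    rw [h, map_add, add_sub_cancel_right, map_sum]
    refine Ideal.sum_mem _ fun j _ => ?_
    rw [Derivation.leibniz, smul_eq_mul, smul_eq_mul]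
    exact Ideal.add_mem _ (Ideal.mul_mem_right _ _ (hPI j)) (Ideal.mul_mem_right _ _ (hQI j))
  have hgdeg : ∀ i, (pderiv i R).totalDegree ≤ d - 2 := fun i =>
    (totalDegree_pderiv_le' i R).trans (by omega)
  -- a minimal prime of `I` below `𝔪`: Krull above, the hypothesis below
  haveI h𝔪max : 𝔪.IsMaximal :=
    RingHom.ker_isMaximal_of_surjective constantCoeff fun a => ⟨C a, constantCoeff_C _ a⟩
  obtain ⟨𝔭, h𝔭min, -⟩ := Ideal.exists_minimalPrimes_le hI𝔪
  have hKrull : 𝔭.height ≤ s.card := Ideal.height_le_card_of_mem_minimalPrimes_span_finset h𝔭min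
  have hlow := hc (fun i => pderiv i R) hgdeg 𝔭 h𝔭min.1.1 fun i => h𝔭min.1.2 (hderiv i)
  have hfin : ((c : ℕ) : ℕ∞) ≤ ((2 * Fintype.card ι : ℕ) : ℕ∞) :=
    hlow.trans (hKrull.trans (by exact_mod_cast hscard))
  exact_mod_cast hfin

section DeltaCut

variable {n k : ℕ}

/-- The robust class bound for general `Δ` and general `f` (CKSV 2022, proof of Thm. 7, with the
power-sum width lemma replaced by `le_two_mul_card_of_eq_sum_mul_add`): with `d' = ⌊d/Δ⌋`, every
class `S_i = {iΔ ≤ φ < (i+1)Δ}`, `1 ≤ i ≤ d' − 1`, has `c ≤ 2(|S_i| + r)`. Assembled in this tree.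
[cite: ChatterjeeKumarSheVolk2022, Theorem 7 (proof)] -/
theorem robust_interval_bound_of_robustHeight {Δ d r c : ℕ} (hΔ : 1 ≤ Δ)
    {f : MvPolynomial (Fin n) K}
    (hc : ∀ g : Fin n → MvPolynomial (Fin n) K, (∀ i, (g i).totalDegree ≤ d - 2) →
      ∀ 𝔭 : Ideal (MvPolynomial (Fin n) K), 𝔭.IsPrime → (∀ i, pderiv i f - g i ∈ 𝔭) →
        (c : ℕ∞) ≤ 𝔭.height)
    {M : Matrix (Fin k) (Fin k) (MvPolynomial (Fin n) K)} (hMtop : IsTopological M)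
    (hdeg : ∀ u v, (M u v).totalDegree ≤ Δ) {φ : Fin k → ℕ}
    (hφ : ∀ u v, M u v ≠ 0 → φ u + (M u v).totalDegree ≤ φ v) {s t : Fin k} (hφs : φ s = 0)
    (hφt : φ t ≤ d) (A B : Fin r → MvPolynomial (Fin n) K) (hA0 : ∀ j, constantCoeff (A j) = 0)
    (hB0 : ∀ j, constantCoeff (B j) = 0) (R : MvPolynomial (Fin n) K) (hRd : R.totalDegree < d)
    (hMst : pathSum M s t = f + ∑ j, A j * B j + R) {i : ℕ} (hi1 : 1 ≤ i)
    (hi2 : i + 1 ≤ d / Δ) :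
    c ≤ 2 * ((Finset.univ.filter fun v => i * Δ ≤ φ v ∧ φ v < (i + 1) * Δ).card + r) := by
  classical
  have hiΔd : (i + 1) * Δ ≤ d :=
    (Nat.mul_le_mul_right Δ hi2).trans (Nat.div_mul_le_self d Δ)
  have hΔi : Δ ≤ i * Δ := by nlinarith
  by_cases hit : (i + 1) * Δ ≤ φ t
  · obtain ⟨Aw, Bw, Ri, hAw, hBw, hRi, hdec⟩ :=
      exists_formalDegInterval_decomposition hMtop hdeg hφ hφs hi1 hΔ hit
    have key : f =
        ∑ x : (Finset.univ.filter fun v => i * Δ ≤ φ v ∧ φ v < (i + 1) * Δ) ⊕ Fin r,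
          Sum.elim (fun w => Aw w - C (constantCoeff (Aw w))) (fun j => -A j) x *
            Sum.elim (fun w => Bw w - C (constantCoeff (Bw w))) B x +
          (Ri + ∑ w, (C (constantCoeff (Aw w)) * Bw w +
            C (constantCoeff (Bw w)) * (Aw w - C (constantCoeff (Aw w)))) - R) := by
      rw [Fintype.sum_sum_type]
      simp only [Sum.elim_inl, Sum.elim_inr]
      have hsplit : ∀ w : (Finset.univ.filter fun v => i * Δ ≤ φ v ∧ φ v < (i + 1) * Δ),
          Aw w * Bw w =
          (Aw w - C (constantCoeff (Aw w))) * (Bw w - C (constantCoeff (Bw w))) +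
            (C (constantCoeff (Aw w)) * Bw w +
              C (constantCoeff (Bw w)) * (Aw w - C (constantCoeff (Aw w)))) := fun w => by ring
      have hF : f = pathSum M s t - ∑ j, A j * B j - R := by
        rw [hMst]; ring
      rw [hF, hdec, Finset.sum_congr rfl fun w _ => hsplit w, Finset.sum_add_distrib]
      simp only [neg_mul, Finset.sum_neg_distrib]
      ring
    have hcard := le_two_mul_card_of_eq_sum_mul_add hc _ _ (fun x => ?_) (fun x => ?_) _ ?_ key
    · rwa [Fintype.card_sum, Fintype.card_coe, Fintype.card_fin] at hcard
    · rcases x with w | j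
      · simp
      · simp [hA0 j]
    · rcases x with w | j
      · simp
      · exact hB0 j
    · have hdeg1 : ∀ w : (Finset.univ.filter fun v => i * Δ ≤ φ v ∧ φ v < (i + 1) * Δ),
          (C (constantCoeff (Aw w)) * Bw w +
            C (constantCoeff (Bw w)) * (Aw w - C (constantCoeff (Aw w)))).totalDegree ≤ d - 1 := by
        intro w
        refine (totalDegree_add _ _).trans (max_le ?_ ?_)
        · refine (totalDegree_mul _ _).trans ?_
          rw [totalDegree_C, zero_add]
          exact (hBw w).trans (by omega)
        · refine (totalDegree_mul _ _).trans ?_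
          rw [totalDegree_C, zero_add]
          refine (totalDegree_sub _ _).trans (max_le ((hAw w).trans (by omega)) ?_)
          rw [totalDegree_C]; exact Nat.zero_le _
      refine Nat.lt_of_le_of_lt (totalDegree_sub _ _) (max_lt ?_ hRd)
      refine Nat.lt_of_le_of_lt (totalDegree_add _ _) (max_lt (by omega) ?_)
      exact Nat.lt_of_le_of_lt (totalDegree_finsetSum_le fun w _ => hdeg1 w) (by omega)
  · have hF : (pathSum M s t).totalDegree < d := by
      have := totalDegree_pathSum_apply_le_of_labelling M φ hφ s t
      rw [hφs, Nat.sub_zero] at this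
      omega
    have key : f = ∑ j, (-A j) * B j + (pathSum M s t - R) := by
      simp only [neg_mul, Finset.sum_neg_distrib]
      rw [hMst]; ring
    have hcard := le_two_mul_card_of_eq_sum_mul_add hc _ _ (fun j => by simp [hA0 j]) hB0 _
      (Nat.lt_of_le_of_lt (totalDegree_sub _ _) (max_lt hF hRd)) key
    rw [Fintype.card_fin] at hcard
    omega

end DeltaCut

/-- **CKSV 2022, Thm. 7 for an arbitrary `f` under a robust singular-locus bound** (printed for
`Σ x_i^n` with Claim 9; here any `f` under the robust height hypothesis `hc`, labels of degree `≤ Δ`): an ABP with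
`k` vertices, labels of degree `≤ Δ` (`1 ≤ Δ`) and formal degree `≤ d` computing
`f + Σ_{j<r} A_j B_j + R` with `A_j(0) = B_j(0) = 0` and `deg R < d` satisfies
`(⌊d/Δ⌋ − 1)·c ≤ 2·k + 2·(⌊d/Δ⌋ − 1)·r`. Proof as the tree's `chatterjeeKumarSheVolk2022_thm_7_general`
(disjoint interval classes, `robust_interval_bound_of_robustHeight`). Assembled in this tree.
[cite: ChatterjeeKumarSheVolk2022, Theorem 7, §1.5 (closing remark)] -/
theorem thm_7_of_robustHeight {n d k r Δ c : ℕ} (hΔ : 1 ≤ Δ) {f : MvPolynomial (Fin n) K}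
    (hc : ∀ g : Fin n → MvPolynomial (Fin n) K, (∀ i, (g i).totalDegree ≤ d - 2) →
      ∀ 𝔭 : Ideal (MvPolynomial (Fin n) K), 𝔭.IsPrime → (∀ i, pderiv i f - g i ∈ 𝔭) →
        (c : ℕ∞) ≤ 𝔭.height)
    (A B : Fin r → MvPolynomial (Fin n) K)
    (hA0 : ∀ j, constantCoeff (A j) = 0) (hB0 : ∀ j, constantCoeff (B j) = 0)
    (R : MvPolynomial (Fin n) K) (hRd : R.totalDegree < d)
    (h : Kumar2019.ABPDegFormalDegreeComputes k Δ d (f + ∑ j, A j * B j + R)) :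
    (d / Δ - 1) * c ≤ 2 * k + 2 * (d / Δ - 1) * r := by
  classical
  obtain ⟨s, t, N, φ, htop, _hs, _ht, hdeg, hφs, hφt, hφ, hcomp⟩ := h
  obtain ⟨S, hSdef⟩ : ∃ S : ℕ → Finset (Fin k),
      S = fun i => Finset.univ.filter fun v => i * Δ ≤ φ v ∧ φ v < (i + 1) * Δ := ⟨_, rfl⟩
  have hclass : ∀ i, 1 ≤ i → i ≤ d / Δ - 1 → c ≤ 2 * ((S i).card + r) := by
    intro i hi1 hi2
    rw [hSdef]
    exact robust_interval_bound_of_robustHeight hΔ hc htop hdeg hφ hφs hφt A B hA0 hB0 R hRd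
      hcomp hi1 (by omega)
  have hdisj : ∀ i ∈ Finset.Icc 1 (d / Δ - 1), ∀ j ∈ Finset.Icc 1 (d / Δ - 1), i ≠ j →
      Disjoint (S i) (S j) := by
    intro i _ j _ hij
    rw [hSdef]
    refine Finset.disjoint_filter.2 fun v _ hvi hvj => hij ?_
    by_contra hne
    rcases Nat.lt_or_gt_of_ne hne with hlt | hlt
    · have : (i + 1) * Δ ≤ j * Δ := Nat.mul_le_mul_right Δ hlt
      omega
    · have : (j + 1) * Δ ≤ i * Δ := Nat.mul_le_mul_right Δ hlt
      omega
  have hcard : ∑ i ∈ Finset.Icc 1 (d / Δ - 1), (S i).card ≤ k := by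
    rw [← Finset.card_biUnion hdisj]
    exact (Finset.card_le_univ _).trans (by rw [Fintype.card_fin])
  calc (d / Δ - 1) * c = ∑ _i ∈ Finset.Icc 1 (d / Δ - 1), c := by
        rw [Finset.sum_const, smul_eq_mul, Nat.card_Icc, Nat.add_sub_cancel]
    _ ≤ ∑ i ∈ Finset.Icc 1 (d / Δ - 1), 2 * ((S i).card + r) :=
        Finset.sum_le_sum fun i hi => hclass i (Finset.mem_Icc.1 hi).1 (Finset.mem_Icc.1 hi).2
    _ = 2 * ∑ i ∈ Finset.Icc 1 (d / Δ - 1), (S i).card + 2 * (d / Δ - 1) * r := by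
        rw [← Finset.mul_sum, Finset.sum_add_distrib, Finset.sum_const, smul_eq_mul, Nat.card_Icc,
          Nat.add_sub_cancel]
        ring
    _ ≤ 2 * k + 2 * (d / Δ - 1) * r := by
        have := Nat.mul_le_mul_left 2 hcard
        omega

/-- The affine-label form (`Δ = 1`, `Kumar2019.ABPOfFormalDegreeComputes`):
`(d − 1)·c ≤ 2k + 2(d − 1)·r`. Assembled in this tree. [cite: ChatterjeeKumarSheVolk2022, Theorem 7] -/
theorem thm_7_of_robustHeight_affine {n d k r c : ℕ} {f : MvPolynomial (Fin n) K}
    (hc : ∀ g : Fin n → MvPolynomial (Fin n) K, (∀ i, (g i).totalDegree ≤ d - 2) →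
      ∀ 𝔭 : Ideal (MvPolynomial (Fin n) K), 𝔭.IsPrime → (∀ i, pderiv i f - g i ∈ 𝔭) →
        (c : ℕ∞) ≤ 𝔭.height)
    (A B : Fin r → MvPolynomial (Fin n) K)
    (hA0 : ∀ j, constantCoeff (A j) = 0) (hB0 : ∀ j, constantCoeff (B j) = 0)
    (R : MvPolynomial (Fin n) K) (hRd : R.totalDegree < d)
    (h : Kumar2019.ABPOfFormalDegreeComputes k d (f + ∑ j, A j * B j + R)) :
    (d - 1) * c ≤ 2 * k + 2 * (d - 1) * r := by
  have h' := thm_7_of_robustHeight (le_refl 1) hc A B hA0 hB0 R hRd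
    ((abpOfFormalDegreeComputes_iff k d _).1 h)
  simpa only [Nat.div_one] using h'

/-- **The instance `c = n` for power sums** (CKSV Claim 9 in height form, `(d : K) ≠ 0`): every
prime `𝔭 ⊇ (d·x_i^{d−1} − g_i : i)` with `deg g_i ≤ d − 2` has height `n` — `K[x]/𝔭` is finite
over `K` (the `x_i^{d−1}` are leading terms: `KumarVolk.moduleFinite_quotient_of_pow_sub_mem`),
hence a field, so `𝔭` is maximal and the dimension formula for the affine domain `K[x]` gives
`height 𝔭 = dim K[x] = n`. With `thm_7_of_robustHeight` this is the tree's
`chatterjeeKumarSheVolk2022_thm_7_general`. [cite: ChatterjeeKumarSheVolk2022, Claim 9] -/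
theorem robustHeight_psum {n d : ℕ} (hd : 2 ≤ d) (hdK : (d : K) ≠ 0)
    (g : Fin n → MvPolynomial (Fin n) K) (hg : ∀ i, (g i).totalDegree ≤ d - 2)
    (𝔭 : Ideal (MvPolynomial (Fin n) K)) (h𝔭 : 𝔭.IsPrime)
    (hle : ∀ i, pderiv i (psum (Fin n) K d) - g i ∈ 𝔭) : (n : ℕ∞) ≤ 𝔭.height := by
  classical
  -- `x_i^{d-1} - d⁻¹ g_i ∈ 𝔭`
  let hh : Fin n → MvPolynomial (Fin n) K := fun i => C (d : K)⁻¹ * g i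
  have hhdeg : ∀ i, (hh i).totalDegree ≤ d - 2 := fun i =>
    (totalDegree_mul _ _).trans (by rw [totalDegree_C, zero_add]; exact hg i)
  have hmem : ∀ i, X i ^ (d - 2 + 1) - hh i ∈ 𝔭 := by
    intro i
    have hd1 : d - 2 + 1 = d - 1 := by omega
    rw [hd1]
    have h1 := Ideal.mul_mem_left 𝔭 (C (d : K)⁻¹) (hle i)
    have hdC : (d : MvPolynomial (Fin n) K) = C (d : K) := (map_natCast C d).symm
    rwa [pderiv_psum, hdC, mul_sub, ← mul_assoc, ← C_mul, inv_mul_cancel₀ hdK, C_1, one_mul] at h1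
  haveI : Module.Finite K (MvPolynomial (Fin n) K ⧸ 𝔭) :=
    KumarVolk.moduleFinite_quotient_of_pow_sub_mem 𝔭 hh hhdeg hmem
  -- a finite-dimensional domain is a field: `𝔭` is maximal
  have h𝔭max : 𝔭.IsMaximal := by
    refine Ideal.Quotient.maximal_of_isField _ ?_
    haveI : Algebra.IsIntegral K (MvPolynomial (Fin n) K ⧸ 𝔭) := Algebra.IsIntegral.of_finite K _
    exact isField_of_isIntegral_of_isField' (Field.toIsField K)
  -- dimension formula: `dim K[x]/𝔭 + height 𝔭 = dim K[x] = n`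
  have h := Literature.RingTheory.KrullDimension.ringKrullDim_quotient_add_height K 𝔭
  rw [ringKrullDim_eq_zero_of_isField ((Ideal.Quotient.maximal_ideal_iff_isField_quotient 𝔭).1
    h𝔭max), MvPolynomial.ringKrullDim_of_isNoetherianRing, ringKrullDim_eq_zero_of_field K,
    zero_add, zero_add, Nat.card_eq_fintype_card, Fintype.card_fin] at h
  have h' : 𝔭.height = n := by exact_mod_cast h
  exact h'.symm.le

end CKSV2022

end Literature.Computability.AlgebraicComplexity

end
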